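import Literature.Analysis.FluidPDE.PassiveVectorTensorDistortedConstFrameModeEnergy
import Literature.Analysis.FluidPDE.PerturbedEnergyGronwall
import HarnessLib

/-!
# Uniqueness of constant-frame distorted weak passive-vector solutions with a coercive tensor, a
# non-degenerate frame and a bounded carrier (frozen-frame twin of `PassiveVectorTensorUniqueness`)

Analysis/FluidPDE proof-support file (everything proved; no definitions, no named facts). For the
constant-frame distorted weak class `Torus.IsWeakTensorPassiveVectorDistortedOn A T 𝔸 b (fun _ _ => G₀) w₀ w`
of `PassiveVectorTensorDistorted.lean` (`∂ₜw + (b·∇)w + A (w·∇)b + G₀ᵀ∇π = 𝓛^{G₀} w`, `∇·(G₀ w) = 0`,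
`w ∈ L^∞_t L²_x`, tested against time-Lipschitz space-smooth fields `Ψ` with `∇·(G₀ Ψ) = 0`) with a
constant tensor in a Legendre–Hadamard window `NearIso 𝔸 lo hi`, `0 < lo` (NO symmetry of `𝔸`), a
NON-DEGENERATE frame (`c |k|² ≤ |G₀ᵀk|²` for all `k`, `0 < c`) and a carrier `b ∈ L^∞((0,T) × T^d)`,
we prove, for EVERY coupling constant `A`:

* `IsWeakTensorPassiveVectorDistortedOn.ae_sq_norm_mFourierCoeff_le_constFrame` — the uniform-in-`k`
  modewise energy bound for datum `0`:
  `‖ŵ(t)(k)‖² ≤ ((1 + A²)/(lo c)) ∫_{(0,t]} ∑ⱼ (‖𝓕(bⱼ w)(τ)(k)‖² + ‖𝓕(wⱼ b)(τ)(k)‖²) dτ` for a.e. `t`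
  — read off from the modewise dissipation bound of the energy identity
  (`…ConstFrameModeEnergy.ae_sq_norm_add_dissipation_le_constFrame` with `w₀ = 0`, dropping the
  nonnegative twisted dissipation `4π² lo |G₀ᵀk|² ∫‖ŵ(k)‖²`; the coupling of the tested mode equations
  through `T_{𝔸^{G₀}}(k)` is already resolved there by the orthonormal-basis summation over `(G₀ᵀk)^⊥`);
* `IsWeakTensorPassiveVectorDistortedOn.ae_eq_zero_of_memLp_top_constFrame` — a solution with datum `0`
  vanishes a.e. (Plancherel, Tonelli, Grönwall a.e. in time — verbatim from the flat file with the new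
  constant `(1 + A²)/(lo c)`);
* `IsWeakTensorPassiveVectorDistortedOn.sub_of_eq_constFrame`, `….ae_eq_of_memLp_top_constFrame` —
  linearity and **uniqueness**: two constant-frame distorted weak solutions with the same datum and the
  same bounded carrier agree for a.e. `t ∈ (0,T)`; the kinematic lemmas `lintegral_mul_sub_lt_top`,
  `ae_lintegral_sq_sub_le` hold for any frame.

In particular (carrier `b = 0`, bounded) the drift-free twisted problem has at most one weak solution —
the «twisted drift-free uniqueness» named in the port map of the frozen-frame road (cell `ad-ideate`,
route `SolenoidalFractalHomogenisation`, K1L_D stmt-AnomalousDissipation-27980, D28-7 §4 risk line: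
identification of the explicit coarse member of the (V_θg) family), and the sibling of the frozen-frame
existence theory (N1 `FrozenDistortedExists`).  Armstrong–Vicol's Lagrangian-coordinate ansatz with the
distortion frozen (arXiv:2305.05048 §4.1).

## Mathlib / tree search

Tree: `PassiveVectorTensorUniqueness` (flat twin: `ae_eq_zero_of_memLp_top`, `sub_of_eq`,
`ae_eq_of_memLp_top`; its coupled-system route through `CoupledModeEnergyBound` is not needed here),
`PassiveVectorTensorDistortedConstFrameModeEnergy` (`ae_sq_norm_add_dissipation_le_constFrame`,
`ae_tsum_enorm_sq_mFourierCoeff_products_le`, kinematic API), `PassiveVectorTensorDistortedDuality`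
(`integrable_weakIntegrand_lipschitzField`), `PassiveVectorTensorDistorted` (the class, `distort_apply`),
`TorusVectorParseval` (`tsum_enorm_sq_mFourierCoeff_complexify`), `PerturbedEnergyGronwall.ae_gronwall_const`.
`rg "DistortedOn.*ae_eq" Literature`: no uniqueness statement for the distorted class existed.

## References

* L. C. Evans, *Partial Differential Equations*, 2nd ed. (AMS 2010), §7.1.2 Thm. 2 (uniqueness of weak
  solutions of linear parabolic equations by the energy method). [`Evans2010`]
* S. Armstrong, V. Vicol, *Anomalous diffusion by fractal homogenization*, Ann. PDE 11 (2025) /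
  arXiv:2305.05048, §4.1 (PDF p. 34). [`ArmstrongVicol2025`]
* U. Frisch, *Turbulence* (CUP 1995), §9.6.3 eq. (9.57) p. 233. [`Frisch1995Turbulence`]
* M. Giaquinta, *Multiple integrals in the calculus of variations and nonlinear elliptic systems*
  (Princeton 1983), Ch. III §2 (2.2). [`Giaquinta1983MultipleIntegrals`]
* R. J. DiPerna, P.-L. Lions, Invent. Math. 98 (1989), §II.1. [`DiPernaLions1989`]
* L. Grafakos, *Classical Fourier Analysis*, 3rd ed., GTM 249 (2014), Prop. 3.2.7. [`Grafakos2014`]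
-/

noncomputable section

open MeasureTheory Set Filter Function TopologicalSpace Complex UnitAddTorus
open scoped ENNReal NNReal InnerProductSpace ComplexConjugate

namespace Literature.Analysis.FluidPDE

namespace Torus

variable {d : Type*} [Fintype d] [DecidableEq d]

/-! ## Plumbing -/

section Plumbing

omit [DecidableEq d] in
/-- An `L^∞` bound on the space–time lift is an a.e. bound on `(0,T) × T^d`. [folklore] -/
private theorem ae_norm_le_prod_of_memLp_top_stLift_cfu {u : ℝ → UnitAddTorus d → EuclideanSpace ℝ d} {T : ℝ}
    (hu : MemLp (FunctionSpaces.Torus.stLift u) ∞ (volume.restrict (Ioo 0 T ×ˢ univ))) :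
    ∃ M : ℝ, 0 ≤ M ∧ ∀ᵐ q ∂(((volume : Measure ℝ).restrict (Ioo 0 T)).prod (volume : Measure (UnitAddTorus d))),
      ‖u q.1 q.2‖ ≤ M := by
  set μ' : Measure (ℝ × EuclideanSpace ℝ d) := volume.restrict (Ioo 0 T ×ˢ univ) with hμ'
  set M : ℝ := (eLpNorm (FunctionSpaces.Torus.stLift u) ∞ μ').toReal with hM
  have hfin : eLpNorm (FunctionSpaces.Torus.stLift u) ∞ μ' < (⊤ : ℝ≥0∞) := hu.eLpNorm_lt_top
  have hae' : ∀ᵐ p ∂μ', ‖FunctionSpaces.Torus.stLift u p‖ ≤ M := by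
    filter_upwards [ae_le_eLpNormEssSup (f := FunctionSpaces.Torus.stLift u) (μ := μ')] with p hp
    rw [← eLpNorm_exponent_top] at hp
    have := ENNReal.toReal_mono hfin.ne hp
    rwa [toReal_enorm] at this
  refine ⟨M, ENNReal.toReal_nonneg, ?_⟩
  have hprod : μ' = ((volume : Measure ℝ).restrict (Ioo 0 T)).prod volume := by
    rw [hμ', Measure.volume_eq_prod, ← Measure.prod_restrict, Measure.restrict_univ]
  rw [hprod] at hae'
  have hq := MeasureTheory.QuasiMeasurePreserving.prodMap
    (Measure.QuasiMeasurePreserving.id ((volume : Measure ℝ).restrict (Ioo 0 T)))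
    (FunctionSpaces.Torus.quasiMeasurePreserving_repr (d := d))
  filter_upwards [hq.ae hae'] with q hq'
  simpa [FunctionSpaces.Torus.stLift] using hq'

omit [DecidableEq d] in
/-- The Fourier coefficients of the zero field vanish. [folklore] -/
private theorem mFourierCoeff_complexify_zero_cfu (k : d → ℤ) :
    mFourierCoeff (FunctionSpaces.EuclideanSpace.complexify ∘ (0 : UnitAddTorus d → EuclideanSpace ℝ d)) k = 0 := by
  rw [FunctionSpaces.Torus.mFourierCoeff_eq_integral_volume]
  simp

omit [DecidableEq d] in
/-- A constant distortion of the zero field is the zero field. [folklore] -/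
private theorem distort_const_zero (G₀ : Matrix d d ℝ) :
    distort (fun _ : UnitAddTorus d => G₀) (0 : UnitAddTorus d → EuclideanSpace ℝ d) = 0 := by
  funext y
  ext a
  rw [distort_apply]
  simp

omit [DecidableEq d] in
/-- The zero field is weakly divergence free. [folklore] -/
private theorem isWeaklyDivFree_zero_cfu :
    FunctionSpaces.Torus.IsWeaklyDivFree (0 : UnitAddTorus d → EuclideanSpace ℝ d) := by
  intro θ hθ
  simp

omit [DecidableEq d] in
/-- Differences of integrable weakly divergence-free fields are weakly divergence free. [folklore] -/
private theorem isWeaklyDivFree_sub_cfu {u₁ u₂ : UnitAddTorus d → EuclideanSpace ℝ d}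
    (h₁ : FunctionSpaces.Torus.IsWeaklyDivFree u₁) (h₂ : FunctionSpaces.Torus.IsWeaklyDivFree u₂)
    (hu₁ : Integrable u₁ volume) (hu₂ : Integrable u₂ volume) :
    FunctionSpaces.Torus.IsWeaklyDivFree (fun x => u₁ x - u₂ x) := by
  intro θ hθ
  simp_rw [inner_sub_left]
  rw [integral_sub (FunctionSpaces.Torus.integrable_inner_of_continuous hu₁ hθ.gradient.continuous)
    (FunctionSpaces.Torus.integrable_inner_of_continuous hu₂ hθ.gradient.continuous), h₁ θ hθ, h₂ θ hθ, sub_zero]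

omit [DecidableEq d] in
/-- A constant distortion is linear: `G₀(u₁ − u₂) = G₀u₁ − G₀u₂` pointwise. [folklore] -/
private theorem distort_const_sub (G₀ : Matrix d d ℝ) (u₁ u₂ : UnitAddTorus d → EuclideanSpace ℝ d) :
    distort (fun _ : UnitAddTorus d => G₀) (fun x => u₁ x - u₂ x) =
      fun x => distort (fun _ : UnitAddTorus d => G₀) u₁ x - distort (fun _ : UnitAddTorus d => G₀) u₂ x := by
  funext y
  ext a
  rw [distort_apply]
  simp only [PiLp.sub_apply, distort_apply, mul_sub, Finset.sum_sub_distrib]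

/-- A constant distortion of an integrable field is integrable (a constant linear map of the fibre).
[folklore] -/
private theorem integrable_distort_const (G₀ : Matrix d d ℝ) {v : UnitAddTorus d → EuclideanSpace ℝ d}
    (hv : Integrable v volume) : Integrable (distort (fun _ : UnitAddTorus d => G₀) v) volume := by
  have e : distort (fun (_ : UnitAddTorus d) => G₀) v =
      fun x => (Matrix.toEuclideanCLM (n := d) (𝕜 := ℝ) G₀) (v x) := by
    funext x
    ext a
    rw [distort_apply, show Matrix.toEuclideanCLM (n := d) (𝕜 := ℝ) G₀ (v x) a =
      WithLp.ofLp (Matrix.toEuclideanCLM (n := d) (𝕜 := ℝ) G₀ (v x)) a from rfl, Matrix.ofLp_toEuclideanCLM]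
    simp [Matrix.mulVec, dotProduct]
  rw [e]
  exact ContinuousLinearMap.integrable_comp _ hv

omit [Fintype d] in
/-- Partial derivatives of constants vanish. [folklore] -/
private theorem partialDeriv_const_cfu (c : ℝ) (l : d) (x : UnitAddTorus d) :
    FunctionSpaces.Torus.partialDeriv l (fun _ : UnitAddTorus d => c) x = 0 := by
  simp [FunctionSpaces.Torus.partialDeriv, FunctionSpaces.Torus.lineDeriv]

/-- `‖f‖₂² = ∫⁻ ‖f‖ₑ²` in `ℝ≥0∞`. [folklore] -/
private theorem eLpNorm_two_pow_two_cfu {α : Type*} [MeasurableSpace α] {μ : Measure α}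
    {E : Type*} [NormedAddCommGroup E] (f : α → E) :
    eLpNorm f 2 μ ^ 2 = ∫⁻ x, ‖f x‖ₑ ^ 2 ∂μ := by
  rw [eLpNorm_eq_lintegral_rpow_enorm_toReal two_ne_zero ENNReal.ofNat_ne_top, ENNReal.toReal_ofNat,
    ← ENNReal.rpow_natCast, ← ENNReal.rpow_mul]
  norm_num

end Plumbing

/-! ## The modewise energy bound for datum `0` and the vanishing of the solution (constant frame) -/

section ModeBound

namespace IsWeakTensorPassiveVectorDistortedOn

variable {A T : ℝ} {𝔸 : Visc4 d} {b w : ℝ → UnitAddTorus d → EuclideanSpace ℝ d} {G₀ : Matrix d d ℝ}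

/-- **Uniform-in-`k` modewise energy bound (constant non-degenerate frame).** For a constant-frame
distorted weak solution with datum `0`, a tensor with `NearIso 𝔸 lo hi`, `0 < lo`, a frame with
`c|k|² ≤ |G₀ᵀk|²` (`0 < c`) and a carrier bounded by `M` a.e. on `(0,T) × T^d`: for every `k` and a.e.
`t ∈ (0,T)`, `‖ŵ(t)(k)‖² ≤ ((1 + A²)/(lo c)) ∫_{(0,t]} ∑ⱼ (‖𝓕(bⱼ w)(τ)(k)‖² + ‖𝓕(wⱼ b)(τ)(k)‖²) dτ`
(the modewise dissipation bound with `w₀ = 0`, dropping the twisted dissipation term).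
[cite: Evans2010, §7.1.2 Thm. 2] [cite: ArmstrongVicol2025, §4.1 (PDF p. 34)] -/
theorem ae_sq_norm_mFourierCoeff_le_constFrame (h : IsWeakTensorPassiveVectorDistortedOn A T 𝔸 b (fun _ _ => G₀) 0 w)
    {lo hi : ℝ} (h𝔸 : NearIso 𝔸 lo hi) (hlo : 0 < lo)
    {c : ℝ} (hc : 0 < c) (hG : ∀ k : d → ℤ, c * FunctionSpaces.Torus.freqNormSq k ≤ ∑ a, twistFreq G₀ k a ^ 2)
    {M : ℝ} (hM : 0 ≤ M)
    (hbM : ∀ᵐ q ∂(((volume : Measure ℝ).restrict (Ioo 0 T)).prod (volume : Measure (UnitAddTorus d))),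
      ‖b q.1 q.2‖ ≤ M) (k : d → ℤ) :
    ∀ᵐ t ∂(volume.restrict (Ioo 0 T)),
      ‖mFourierCoeff (FunctionSpaces.EuclideanSpace.complexify ∘ w t) k‖ ^ 2 ≤
        ((1 + A ^ 2) / (lo * c)) * ∫ τ in Ioc 0 t, ∑ j,
          (‖mFourierCoeff (FunctionSpaces.EuclideanSpace.complexify ∘ fun x => b τ x j • w τ x) k‖ ^ 2 +
            ‖mFourierCoeff (FunctionSpaces.EuclideanSpace.complexify ∘ fun x => w τ x j • b τ x) k‖ ^ 2) := by
  have hdiv₀ : FunctionSpaces.Torus.IsWeaklyDivFree (distort (fun _ : UnitAddTorus d => G₀)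
      (0 : UnitAddTorus d → EuclideanSpace ℝ d)) := by
    rw [distort_const_zero]
    exact isWeaklyDivFree_zero_cfu
  have hmode := h.ae_sq_norm_add_dissipation_le_constFrame h𝔸 hlo hc hG MemLp.zero hdiv₀ hM hbM k
  filter_upwards [hmode] with t ht
  rw [mFourierCoeff_complexify_zero_cfu, norm_zero] at ht
  have hI0 : 0 ≤ ∫ τ in Ioc 0 t, ‖mFourierCoeff (FunctionSpaces.EuclideanSpace.complexify ∘ w τ) k‖ ^ 2 :=
    setIntegral_nonneg measurableSet_Ioc fun τ _ => sq_nonneg _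
  have hdis : 0 ≤ 4 * Real.pi ^ 2 * lo * (∑ a, twistFreq G₀ k a ^ 2) *
      ∫ τ in Ioc 0 t, ‖mFourierCoeff (FunctionSpaces.EuclideanSpace.complexify ∘ w τ) k‖ ^ 2 :=
    mul_nonneg (mul_nonneg (by positivity) (Finset.sum_nonneg fun a _ => sq_nonneg _)) hI0
  simp only [ne_eq, OfNat.ofNat_ne_zero, not_false_eq_true, zero_pow, zero_add] at ht
  linarith

/-- **A constant-frame distorted weak solution with datum `0` and bounded carrier vanishes**
(`NearIso 𝔸 lo hi`, `0 < lo`, `c|k|² ≤ |G₀ᵀk|²` with `0 < c`, `b ∈ L^∞((0,T) × T^d)`, any `A`):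
`w(t) = 0` a.e. for a.e. `t ∈ (0,T)`.  Summing the modewise bounds over `k` (Parseval for vector fields,
Tonelli) gives `‖w(t)‖²_{L²} ≤ (2dM²(1+A²)/(lo c)) ∫₀ᵗ ‖w‖²_{L²}` for a.e. `t`, and Grönwall a.e. in time
(`ae_gronwall_const`) concludes. [cite: Evans2010, §7.1.2 Thm. 2] [cite: ArmstrongVicol2025, §4.1 (PDF p. 34)] -/
theorem ae_eq_zero_of_memLp_top_constFrame (h : IsWeakTensorPassiveVectorDistortedOn A T 𝔸 b (fun _ _ => G₀) 0 w)
    {lo hi : ℝ} (h𝔸 : NearIso 𝔸 lo hi) (hlo : 0 < lo)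
    {c : ℝ} (hc : 0 < c) (hG : ∀ k : d → ℤ, c * FunctionSpaces.Torus.freqNormSq k ≤ ∑ a, twistFreq G₀ k a ^ 2)
    (hb : MemLp (FunctionSpaces.Torus.stLift b) ∞ (volume.restrict (Ioo 0 T ×ˢ univ))) :
    ∀ᵐ t ∂(volume.restrict (Ioo 0 T)), w t =ᵐ[volume] 0 := by
  obtain ⟨M, hM, hbM⟩ := ae_norm_le_prod_of_memLp_top_stLift_cfu hb
  obtain ⟨C, hC⟩ := h.ae_lintegral_sq_le
  set D : ℝ := (1 + A ^ 2) / (lo * c) with hD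
  have hD0 : 0 ≤ D := by positivity
  set Φ : ℝ → ℝ≥0∞ := fun t => ∫⁻ x, ‖w t x‖ₑ ^ 2 with hΦ
  set F : d → (d → ℤ) → ℝ → EuclideanSpace ℂ d := fun j k τ =>
    mFourierCoeff (FunctionSpaces.EuclideanSpace.complexify ∘ fun x => b τ x j • w τ x) k with hF
  set G : d → (d → ℤ) → ℝ → EuclideanSpace ℂ d := fun j k τ =>
    mFourierCoeff (FunctionSpaces.EuclideanSpace.complexify ∘ fun x => w τ x j • b τ x) k with hGdef
  have hFi : ∀ j k, IntegrableOn (F j k) (Ioo 0 T) := fun j k => h.integrableOn_mFourierCoeff_carrier_smul j k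
  have hGi : ∀ j k, IntegrableOn (G j k) (Ioo 0 T) := fun j k => h.integrableOn_mFourierCoeff_smul_carrier j k
  have hslice := h.ae_tsum_enorm_sq_mFourierCoeff_products_le hM hbM
  -- Plancherel bound for the fluxes: `∑ₖ γₖ(τ) ≤ 2 d M² Φ τ` a.e.
  have hflux : ∀ᵐ τ ∂(volume.restrict (Ioo 0 T)),
      ∑' k, ∑ j, (‖F j k τ‖ₑ ^ 2 + ‖G j k τ‖ₑ ^ 2) ≤ (Fintype.card d : ℝ≥0∞) * (2 * (ENNReal.ofReal (M ^ 2) * Φ τ)) := by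
    filter_upwards [hslice] with τ hτ
    rw [Summable.tsum_finsetSum (fun _ _ => ENNReal.summable)]
    calc ∑ j, ∑' k, (‖F j k τ‖ₑ ^ 2 + ‖G j k τ‖ₑ ^ 2)
        ≤ ∑ _j : d, 2 * (ENNReal.ofReal (M ^ 2) * Φ τ) := by
          refine Finset.sum_le_sum fun j _ => ?_
          rw [ENNReal.tsum_add, two_mul]
          exact add_le_add (hτ.2 j).1 (hτ.2 j).2
      _ = (Fintype.card d : ℝ≥0∞) * (2 * (ENNReal.ofReal (M ^ 2) * Φ τ)) := by
          rw [Finset.sum_const, Finset.card_univ, nsmul_eq_mul]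
  -- all modewise bounds at once
  have hmodes : ∀ᵐ t ∂(volume.restrict (Ioo 0 T)), ∀ k : d → ℤ,
      ‖mFourierCoeff (FunctionSpaces.EuclideanSpace.complexify ∘ w t) k‖ ^ 2 ≤
        D * ∫ τ in Ioc 0 t, ∑ j, (‖F j k τ‖ ^ 2 + ‖G j k τ‖ ^ 2) :=
    ae_all_iff.2 fun k => h.ae_sq_norm_mFourierCoeff_le_constFrame h𝔸 hlo hc hG hM hbM k
  -- integrability of the `γₖ`
  have hγi : ∀ k, IntegrableOn (fun τ => ∑ j, (‖F j k τ‖ ^ 2 + ‖G j k τ‖ ^ 2)) (Ioo 0 T) :=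
    fun k => h.integrableOn_fluxEnergy hM hbM k
  -- the integral inequality for `Φ`
  set L : ℝ≥0∞ := ENNReal.ofReal D * ((Fintype.card d : ℝ≥0∞) * (2 * ENNReal.ofReal (M ^ 2))) with hL
  have hLtop : L ≠ ⊤ := by
    rw [hL]
    exact ENNReal.mul_ne_top ENNReal.ofReal_ne_top
      (ENNReal.mul_ne_top (ENNReal.natCast_ne_top _) (ENNReal.mul_ne_top ENNReal.ofNat_ne_top ENNReal.ofReal_ne_top))
  have hΦ : ∀ᵐ t ∂(volume.restrict (Ioo 0 T)), Φ t ≤ 0 + L * ∫⁻ τ in Ioo 0 t, Φ τ := by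
    filter_upwards [hmodes, hslice, ae_restrict_mem measurableSet_Ioo] with t ht hts htT
    rw [zero_add]
    have hsub : Ioc 0 t ⊆ Ioo 0 T := fun τ hτ => ⟨hτ.1, hτ.2.trans_lt htT.2⟩
    rw [hΦ]
    simp only
    rw [← FunctionSpaces.Torus.tsum_enorm_sq_mFourierCoeff_complexify hts.1]
    have hk : ∀ k, ‖mFourierCoeff (FunctionSpaces.EuclideanSpace.complexify ∘ w t) k‖ₑ ^ 2 ≤
        ENNReal.ofReal D * ∫⁻ τ in Ioc 0 t, ∑ j, (‖F j k τ‖ₑ ^ 2 + ‖G j k τ‖ₑ ^ 2) := by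
      intro k
      have hγt : Integrable (fun τ => ∑ j, (‖F j k τ‖ ^ 2 + ‖G j k τ‖ ^ 2)) (volume.restrict (Ioc 0 t)) :=
        (hγi k).mono_set hsub
      have e1 : ‖mFourierCoeff (FunctionSpaces.EuclideanSpace.complexify ∘ w t) k‖ₑ ^ 2 =
          ENNReal.ofReal (‖mFourierCoeff (FunctionSpaces.EuclideanSpace.complexify ∘ w t) k‖ ^ 2) := by
        rw [← ofReal_norm, ENNReal.ofReal_pow (norm_nonneg _)]
      have e2 : ∫⁻ τ in Ioc 0 t, ∑ j, (‖F j k τ‖ₑ ^ 2 + ‖G j k τ‖ₑ ^ 2) =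
          ∫⁻ τ in Ioc 0 t, ENNReal.ofReal (∑ j, (‖F j k τ‖ ^ 2 + ‖G j k τ‖ ^ 2)) := by
        refine lintegral_congr fun τ => ?_
        rw [ENNReal.ofReal_sum_of_nonneg (fun j _ => by positivity)]
        refine Finset.sum_congr rfl fun j _ => ?_
        rw [ENNReal.ofReal_add (sq_nonneg _) (sq_nonneg _), ← ofReal_norm, ENNReal.ofReal_pow (norm_nonneg _),
          ← ofReal_norm, ENNReal.ofReal_pow (norm_nonneg _)]
      rw [e1, e2, ← ofReal_integral_eq_lintegral_ofReal hγt
          (ae_of_all _ fun τ => Finset.sum_nonneg fun j _ => by positivity), ← ENNReal.ofReal_mul hD0]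
      exact ENNReal.ofReal_le_ofReal (ht k)
    have hmeas : ∀ k, AEMeasurable (fun τ => ∑ j, (‖F j k τ‖ₑ ^ 2 + ‖G j k τ‖ₑ ^ 2)) (volume.restrict (Ioc 0 t)) := by
      intro k
      refine Finset.aemeasurable_fun_sum _ fun j _ => ?_
      exact (((hFi j k).aestronglyMeasurable.aemeasurable.mono_set hsub).enorm.pow_const 2).add
        (((hGi j k).aestronglyMeasurable.aemeasurable.mono_set hsub).enorm.pow_const 2)
    calc ∑' k, ‖mFourierCoeff (FunctionSpaces.EuclideanSpace.complexify ∘ w t) k‖ₑ ^ 2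
        ≤ ∑' k, ENNReal.ofReal D * ∫⁻ τ in Ioc 0 t, ∑ j, (‖F j k τ‖ₑ ^ 2 + ‖G j k τ‖ₑ ^ 2) :=
          ENNReal.tsum_le_tsum hk
      _ = ENNReal.ofReal D * ∫⁻ τ in Ioc 0 t, ∑' k, ∑ j, (‖F j k τ‖ₑ ^ 2 + ‖G j k τ‖ₑ ^ 2) := by
          rw [ENNReal.tsum_mul_left, lintegral_tsum hmeas]
      _ ≤ ENNReal.ofReal D * ∫⁻ τ in Ioc 0 t, (Fintype.card d : ℝ≥0∞) * (2 * (ENNReal.ofReal (M ^ 2) * Φ τ)) := by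
          gcongr 1
          exact lintegral_mono_ae (ae_restrict_of_ae_restrict_of_subset hsub hflux)
      _ = L * ∫⁻ τ in Ioo 0 t, Φ τ := by
          rw [lintegral_const_mul' _ _ (ENNReal.natCast_ne_top _),
            lintegral_const_mul' _ _ ENNReal.ofNat_ne_top,
            lintegral_const_mul' _ _ ENNReal.ofReal_ne_top,
            setLIntegral_congr (Ioo_ae_eq_Ioc (μ := (volume : Measure ℝ))), hL]
          ring
  have hΦC : ∀ᵐ t ∂(volume.restrict (Ioo 0 T)), Φ t ≤ (C : ℝ≥0∞) := hC
  have hGr := ae_gronwall_const (S := T) (φ := Φ) (B := 0) (M := C) (L := L) (by simp) ENNReal.coe_ne_top hLtop hΦC hΦ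
  filter_upwards [hGr, h.aestronglyMeasurable_uncurry.prodMk_left] with t ht hm
  have h0 : Φ t = 0 := le_antisymm (by simpa using ht) bot_le
  have hae : ∀ᵐ x ∂volume, ‖w t x‖ₑ ^ 2 = 0 :=
    (lintegral_eq_zero_iff' (hm.enorm.pow_const 2)).1 h0
  filter_upwards [hae] with x hx
  have hx' : ‖w t x‖ₑ = 0 := by simpa using hx
  simpa [enorm_eq_zero] using hx'

end IsWeakTensorPassiveVectorDistortedOn

end ModeBound

/-! ## Uniqueness -/

section Uniqueness

namespace IsWeakTensorPassiveVectorDistortedOn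

variable {A T : ℝ} {𝔸 : Visc4 d} {b w₁ w₂ : ℝ → UnitAddTorus d → EuclideanSpace ℝ d}
  {G : ℝ → UnitAddTorus d → Matrix d d ℝ} {G₀ : Matrix d d ℝ} {w₀ : UnitAddTorus d → EuclideanSpace ℝ d}

/-- `‖b‖ ‖w₁ - w₂‖ ∈ L¹((0,T) × T^d)` for two distorted solutions with the same carrier (any frame).
[cite: DiPernaLions1989, §II.1] -/
theorem lintegral_mul_sub_lt_top (h₁ : IsWeakTensorPassiveVectorDistortedOn A T 𝔸 b G w₀ w₁)
    (h₂ : IsWeakTensorPassiveVectorDistortedOn A T 𝔸 b G w₀ w₂) :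
    ∫⁻ t in Ioo 0 T, ∫⁻ x, ‖b t x‖ₑ * ‖w₁ t x - w₂ t x‖ₑ < ⊤ := by
  set μT : Measure ℝ := (volume : Measure ℝ).restrict (Ioo 0 T) with hμT
  have hmu := h₁.aestronglyMeasurable_uncurry_carrier
  have hm₁ := h₁.aestronglyMeasurable_uncurry
  have hm₂ := h₂.aestronglyMeasurable_uncurry
  have hF : AEMeasurable (fun p : ℝ × UnitAddTorus d => ‖b p.1 p.2‖ₑ * ‖w₁ p.1 p.2 - w₂ p.1 p.2‖ₑ)
      (μT.prod volume) := hmu.enorm.mul (hm₁.sub hm₂).enorm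
  have hF₁ : AEMeasurable (fun p : ℝ × UnitAddTorus d => ‖b p.1 p.2‖ₑ * ‖w₁ p.1 p.2‖ₑ) (μT.prod volume) :=
    hmu.enorm.mul hm₁.enorm
  have hF₂ : AEMeasurable (fun p : ℝ × UnitAddTorus d => ‖b p.1 p.2‖ₑ * ‖w₂ p.1 p.2‖ₑ) (μT.prod volume) :=
    hmu.enorm.mul hm₂.enorm
  have e : ∫⁻ t in Ioo 0 T, ∫⁻ x, ‖b t x‖ₑ * ‖w₁ t x - w₂ t x‖ₑ =
      ∫⁻ p, ‖b p.1 p.2‖ₑ * ‖w₁ p.1 p.2 - w₂ p.1 p.2‖ₑ ∂(μT.prod volume) := (lintegral_prod _ hF).symm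
  rw [e]
  calc ∫⁻ p, ‖b p.1 p.2‖ₑ * ‖w₁ p.1 p.2 - w₂ p.1 p.2‖ₑ ∂(μT.prod volume)
      ≤ ∫⁻ p, (‖b p.1 p.2‖ₑ * ‖w₁ p.1 p.2‖ₑ + ‖b p.1 p.2‖ₑ * ‖w₂ p.1 p.2‖ₑ) ∂(μT.prod volume) := by
        refine lintegral_mono fun p => ?_
        rw [← mul_add]
        gcongr
        exact enorm_sub_le
    _ = (∫⁻ p, ‖b p.1 p.2‖ₑ * ‖w₁ p.1 p.2‖ₑ ∂(μT.prod volume)) +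
          ∫⁻ p, ‖b p.1 p.2‖ₑ * ‖w₂ p.1 p.2‖ₑ ∂(μT.prod volume) := lintegral_add_left' hF₁ _
    _ = (∫⁻ t in Ioo 0 T, ∫⁻ x, ‖b t x‖ₑ * ‖w₁ t x‖ₑ) + ∫⁻ t in Ioo 0 T, ∫⁻ x, ‖b t x‖ₑ * ‖w₂ t x‖ₑ := by
        rw [lintegral_prod _ hF₁, lintegral_prod _ hF₂]
    _ < ⊤ := ENNReal.add_lt_top.2 ⟨h₁.lintegral_mul_lt_top, h₂.lintegral_mul_lt_top⟩

/-- `w₁ - w₂ ∈ L^∞(0,T; L²)` (any frame). [cite: DiPernaLions1989, §II.1] -/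
theorem ae_lintegral_sq_sub_le (h₁ : IsWeakTensorPassiveVectorDistortedOn A T 𝔸 b G w₀ w₁)
    (h₂ : IsWeakTensorPassiveVectorDistortedOn A T 𝔸 b G w₀ w₂) :
    ∃ C : ℝ≥0, ∀ᵐ t ∂(volume.restrict (Ioo 0 T)), ∫⁻ x, ‖w₁ t x - w₂ t x‖ₑ ^ 2 ≤ C := by
  obtain ⟨C₁, hC₁⟩ := h₁.exists_eLpNorm_le
  obtain ⟨C₂, hC₂⟩ := h₂.exists_eLpNorm_le
  refine ⟨(C₁ + C₂) ^ 2, ?_⟩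
  filter_upwards [hC₁, hC₂, h₁.ae_memLp_two, h₂.ae_memLp_two] with t hc₁ hc₂ hm₁ hm₂
  have hsub : eLpNorm (w₁ t - w₂ t) 2 volume ≤ C₁ + C₂ :=
    (eLpNorm_sub_le hm₁.1 hm₂.1 one_le_two).trans (add_le_add hc₁ hc₂)
  have e : ∫⁻ x, ‖w₁ t x - w₂ t x‖ₑ ^ 2 = eLpNorm (w₁ t - w₂ t) 2 volume ^ 2 := by
    rw [eLpNorm_two_pow_two_cfu]
    rfl
  rw [e, ENNReal.coe_pow, ENNReal.coe_add]
  exact pow_le_pow_left' hsub 2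

/-- **Linearity of the constant-frame distorted class**: the difference of two constant-frame distorted
weak solutions with the same carrier, coupling `A`, tensor, frame and datum is one with datum `0`
(the distorted constraint and the admissible test class are linear; the space–time weak integrand of each
solution is integrable for time-Lipschitz space-smooth tests, `integrable_weakIntegrand_lipschitzField`,
the constant frame having trivially `C¹` slices). [cite: DiPernaLions1989, §II.1] [cite: ArmstrongVicol2025, §4.1 (PDF p. 34)] -/
theorem sub_of_eq_constFrame (h₁ : IsWeakTensorPassiveVectorDistortedOn A T 𝔸 b (fun _ _ => G₀) w₀ w₁)
    (h₂ : IsWeakTensorPassiveVectorDistortedOn A T 𝔸 b (fun _ _ => G₀) w₀ w₂) :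
    IsWeakTensorPassiveVectorDistortedOn A T 𝔸 b (fun _ _ => G₀) 0 (fun t x => w₁ t x - w₂ t x) where
  aestronglyMeasurable := h₁.aestronglyMeasurable.sub h₂.aestronglyMeasurable
  aestronglyMeasurable_carrier := h₁.aestronglyMeasurable_carrier
  ae_lintegral_sq_le := ae_lintegral_sq_sub_le h₁ h₂
  lintegral_carrier_lt_top := h₁.lintegral_carrier_lt_top
  lintegral_mul_lt_top := lintegral_mul_sub_lt_top h₁ h₂
  ae_isWeaklyDivFree_carrier := h₁.ae_isWeaklyDivFree_carrier
  ae_isWeaklyDivFree_distort := by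
    filter_upwards [h₁.ae_isWeaklyDivFree_distort, h₂.ae_isWeaklyDivFree_distort, h₁.ae_memLp_two, h₂.ae_memLp_two]
      with t hd₁ hd₂ hm₁ hm₂
    have e : distort ((fun (_ : ℝ) (_ : UnitAddTorus d) => G₀) t) (fun x => w₁ t x - w₂ t x) =
        fun x => distort (fun _ : UnitAddTorus d => G₀) (w₁ t) x - distort (fun _ : UnitAddTorus d => G₀) (w₂ t) x :=
      distort_const_sub G₀ (w₁ t) (w₂ t)
    rw [e]
    exact isWeaklyDivFree_sub_cfu hd₁ hd₂ (integrable_distort_const G₀ (hm₁.integrable one_le_two))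
      (integrable_distort_const G₀ (hm₂.integrable one_le_two))
  weak_eq Ψ hΨ hΨdiv := by
    have e₁ := h₁.weak_eq Ψ hΨ hΨdiv
    have e₂ := h₂.weak_eq Ψ hΨ hΨdiv
    have hG1 : ∀ (t : ℝ) (i j : d), FunctionSpaces.Torus.IsContDiff 1
        (fun y : UnitAddTorus d => (fun (_ : ℝ) (_ : UnitAddTorus d) => G₀) t y i j) :=
      fun _ i j => FunctionSpaces.Torus.isContDiff_const (G₀ i j)
    have hGc : ∀ i j : d, Continuous (uncurry fun (t : ℝ) (y : UnitAddTorus d) =>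
        (fun (_ : ℝ) (_ : UnitAddTorus d) => G₀) t y i j) := fun _ _ => continuous_const
    have hGd : ∀ (i j e' : d), Continuous (uncurry fun (t : ℝ) (y : UnitAddTorus d) =>
        FunctionSpaces.Torus.partialDeriv e' (fun y => (fun (_ : ℝ) (_ : UnitAddTorus d) => G₀) t y i j) y) := by
      intro i j e'
      have e : (uncurry fun (t : ℝ) (y : UnitAddTorus d) =>
          FunctionSpaces.Torus.partialDeriv e' (fun y => (fun (_ : ℝ) (_ : UnitAddTorus d) => G₀) t y i j) y) =
          fun _ => (0 : ℝ) := by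
        funext p
        simp only [uncurry]
        exact partialDeriv_const_cfu (G₀ i j) e' p.2
      rw [e]
      exact continuous_const
    have hI₁ := h₁.integrable_weakIntegrand_lipschitzField (ψ := Ψ) hΨ.isSmooth_slice
      hΨ.continuous_uncurry_iterPartialDeriv hΨ.lipschitz hG1 hGc hGd 𝔸
    have hI₂ := h₂.integrable_weakIntegrand_lipschitzField (ψ := Ψ) hΨ.isSmooth_slice
      hΨ.continuous_uncurry_iterPartialDeriv hΨ.lipschitz hG1 hGc hGd 𝔸
    have hpt : ∀ t x, ⟪w₁ t x - w₂ t x, FunctionSpaces.Torus.timeDeriv Ψ t x +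
          FunctionSpaces.Torus.convect (b t) (Ψ t) x +
          viscAdjVar (fun y => Visc4.conj ((fun (_ : ℝ) (_ : UnitAddTorus d) => G₀) t y) 𝔸) (Ψ t) x⟫_ℝ +
        A * ⟪b t x, FunctionSpaces.Torus.convect (fun y => w₁ t y - w₂ t y) (Ψ t) x⟫_ℝ =
        (⟪w₁ t x, FunctionSpaces.Torus.timeDeriv Ψ t x +
            FunctionSpaces.Torus.convect (b t) (Ψ t) x +
            viscAdjVar (fun y => Visc4.conj ((fun (_ : ℝ) (_ : UnitAddTorus d) => G₀) t y) 𝔸) (Ψ t) x⟫_ℝ +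
          A * ⟪b t x, FunctionSpaces.Torus.convect (w₁ t) (Ψ t) x⟫_ℝ) -
        (⟪w₂ t x, FunctionSpaces.Torus.timeDeriv Ψ t x +
            FunctionSpaces.Torus.convect (b t) (Ψ t) x +
            viscAdjVar (fun y => Visc4.conj ((fun (_ : ℝ) (_ : UnitAddTorus d) => G₀) t y) 𝔸) (Ψ t) x⟫_ℝ +
          A * ⟪b t x, FunctionSpaces.Torus.convect (w₂ t) (Ψ t) x⟫_ℝ) := by
      intro t x
      simp only [FunctionSpaces.Torus.convect, map_sub, inner_sub_left, inner_sub_right]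
      ring
    have hslice : ∀ᵐ t ∂(volume.restrict (Ioo 0 T)),
        ∫ x, (⟪w₁ t x - w₂ t x, FunctionSpaces.Torus.timeDeriv Ψ t x +
            FunctionSpaces.Torus.convect (b t) (Ψ t) x +
            viscAdjVar (fun y => Visc4.conj ((fun (_ : ℝ) (_ : UnitAddTorus d) => G₀) t y) 𝔸) (Ψ t) x⟫_ℝ +
          A * ⟪b t x, FunctionSpaces.Torus.convect (fun y => w₁ t y - w₂ t y) (Ψ t) x⟫_ℝ) =
        (∫ x, (⟪w₁ t x, FunctionSpaces.Torus.timeDeriv Ψ t x +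
            FunctionSpaces.Torus.convect (b t) (Ψ t) x +
            viscAdjVar (fun y => Visc4.conj ((fun (_ : ℝ) (_ : UnitAddTorus d) => G₀) t y) 𝔸) (Ψ t) x⟫_ℝ +
          A * ⟪b t x, FunctionSpaces.Torus.convect (w₁ t) (Ψ t) x⟫_ℝ)) -
        ∫ x, (⟪w₂ t x, FunctionSpaces.Torus.timeDeriv Ψ t x +
            FunctionSpaces.Torus.convect (b t) (Ψ t) x +
            viscAdjVar (fun y => Visc4.conj ((fun (_ : ℝ) (_ : UnitAddTorus d) => G₀) t y) 𝔸) (Ψ t) x⟫_ℝ +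
          A * ⟪b t x, FunctionSpaces.Torus.convect (w₂ t) (Ψ t) x⟫_ℝ) := by
      filter_upwards [hI₁.prod_right_ae, hI₂.prod_right_ae] with t ht₁ ht₂
      rw [← integral_sub ht₁ ht₂]
      exact integral_congr_ae (Eventually.of_forall fun x => hpt t x)
    have key : (∫ t in Ioo 0 T, ∫ x, (⟪w₁ t x - w₂ t x, FunctionSpaces.Torus.timeDeriv Ψ t x +
            FunctionSpaces.Torus.convect (b t) (Ψ t) x +
            viscAdjVar (fun y => Visc4.conj ((fun (_ : ℝ) (_ : UnitAddTorus d) => G₀) t y) 𝔸) (Ψ t) x⟫_ℝ +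
          A * ⟪b t x, FunctionSpaces.Torus.convect (fun y => w₁ t y - w₂ t y) (Ψ t) x⟫_ℝ)) +
        ∫ x, ⟪(0 : UnitAddTorus d → EuclideanSpace ℝ d) x, Ψ 0 x⟫_ℝ = 0 := by
      rw [integral_congr_ae hslice, integral_sub hI₁.integral_prod_left hI₂.integral_prod_left]
      simp only [Pi.zero_apply, inner_zero_left, integral_zero, add_zero]
      linarith
    exact key

/-- **Uniqueness of constant-frame distorted weak passive-vector solutions with a coercive tensor, a
non-degenerate frame and a bounded carrier.** For a tensor with `NearIso 𝔸 lo hi`, `0 < lo`, a frame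
with `c|k|² ≤ |G₀ᵀk|²` (`0 < c`), any coupling `A` and a carrier `b ∈ L^∞((0,T) × T^d)`, two weak
solutions `w₁, w₂ ∈ L^∞_t L²_x` of `∂ₜw + (b·∇)w + A (w·∇)b + G₀ᵀ∇π = 𝓛^{G₀} w`, `∇·(G₀ w) = 0`, with the
same datum coincide for a.e. `t ∈ (0,T)` (difference ↦ datum `0` by `sub_of_eq_constFrame`, then
`ae_eq_zero_of_memLp_top_constFrame`).  With `b = 0` this is the uniqueness of the drift-free twisted
problem. [cite: Evans2010, §7.1.2 Thm. 2] [cite: ArmstrongVicol2025, §4.1 (PDF p. 34)]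
[cite: Frisch1995Turbulence, §9.6.3 eq. (9.57) p. 233] -/
theorem ae_eq_of_memLp_top_constFrame {lo hi : ℝ} (h𝔸 : NearIso 𝔸 lo hi) (hlo : 0 < lo)
    {c : ℝ} (hc : 0 < c) (hG : ∀ k : d → ℤ, c * FunctionSpaces.Torus.freqNormSq k ≤ ∑ a, twistFreq G₀ k a ^ 2)
    (h₁ : IsWeakTensorPassiveVectorDistortedOn A T 𝔸 b (fun _ _ => G₀) w₀ w₁)
    (h₂ : IsWeakTensorPassiveVectorDistortedOn A T 𝔸 b (fun _ _ => G₀) w₀ w₂)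
    (hb : MemLp (FunctionSpaces.Torus.stLift b) ∞ (volume.restrict (Ioo 0 T ×ˢ univ))) :
    ∀ᵐ t ∂(volume.restrict (Ioo 0 T)), w₁ t =ᵐ[volume] w₂ t := by
  filter_upwards [(sub_of_eq_constFrame h₁ h₂).ae_eq_zero_of_memLp_top_constFrame h𝔸 hlo hc hG hb] with t ht
  filter_upwards [ht] with x hx
  exact sub_eq_zero.1 hx

end IsWeakTensorPassiveVectorDistortedOn

end Uniqueness

end Torus

end Literature.Analysis.FluidPDE

end
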